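import Summits.CriticalPhenomena.PercolationContinuityZ3.Theorems.SahiMasterFamilyFCombAllThirdEvents
import Summits.CriticalPhenomena.PercolationContinuityZ3.Theorems.SahiMasterFamilyFCombBridge
import HarnessLib

/-!
# The master-family `F`-inequality for EVERY increasing third event, in the tree's vocabulary; the unconditional D0-core `MD₃`

Support file (cell `prim-bnk`, seat bnk-2 gen 21; `--supports stmt-CriticalPhenomena-4575`; write-up
`run/shared/lean/prim/prim-l12/PROOF-F-inequality.md`).  No definition, no `sorry`, standard axioms.

`…FCombAllThirdEvents` proves the cube theorem `SahiFComb.F_nonneg_of_monotone`: for every `n`, `p ∈ [0,1]^n` and all monotone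
`A, B, G` on `Fin n → Bool`, `(1 + μ_pG)μ_p(ABG) − μ_pG·μ_p(AB) − μ_p(AG)μ_p(BG) ≥ 0`.  The bridge `…FCombBridge` (representation of
`Set (Set (Fin n))` events by Boolean functions, transport along `ι ≃ Fin n`) turns it into:

* **`fIneq_nonneg`** — for every finite `ι`, every `p : ι → [0,1]` and ALL increasing `A, B, G ⊆ Set (Set ι)`:
  `(1 + 𝔼1_G)·𝔼1_{A∩B∩G} − 𝔼1_G·𝔼1_{A∩B} − 𝔼1_{A∩G}·𝔼1_{B∩G} ≥ 0` for the product measure `bernoulliWeight p`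
  (gen 20/21 had this for read-once and threshold `G` only: `fIneq_nonneg_of_readOnce`, `fIneq_nonneg_of_threshold`);
* **`sahiE_three_ge_sq_minor`** — the D0-core consequence `(1−p_e)²E₃(U⁰) + p_e²E₃(U¹) ≤ E₃(U)` of
  `Pointwise.sahiE_three_ge_sq_minor_of_F_nonneg`, now with NO hypothesis on the shape of the (`e`-free) third member.
HONEST FRAMING: plumbing on top of the combinatorial theorem `SahiFComb.comb_sum_nonneg`; the mathematics is in
`…FCombShiftDet` (unimodularity of shifted inclusion matrices), `…FCombDisjointMatching` (the Kleitman–compression matching) and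
`…FCombAllThirdEvents`. [this work]
-/

noncomputable section

open scoped Classical

namespace Summit.CriticalPhenomena.PercolationContinuityZ3.Theorems

namespace SahiFCombBridge

open Finset Function
open Literature.Combinatorics.Sahi2008
open Literature.Probability.Percolation.DecisionTree (ind ind_of_mem ind_of_not_mem ind_nonneg)
open SahiBlockExchangeable (cubeEquivSet mem_cubeEquivSet)
open SahiCoordinateTwoThirds (ex_bernoulliWeight_eq_sum_cube)
open ThreePartition (comapFam comapFam_inter)
open SahiC4CombBridge (isUpperSet_comapFam sahiE_bernoulliWeight_comap_equiv)

/-! ### 1. The cube `Fin n` -/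

section Cube

variable {n : ℕ}

/-- **`F ≥ 0` on the cube `Fin n`, tree vocabulary, ALL increasing `A, B, G`.** [this work] -/
theorem fIneq_nonneg_fin (p : Fin n → unitInterval) (A B G : Set (Set (Fin n)))
    (hA : IsUpperSet A) (hB : IsUpperSet B) (hG : IsUpperSet G) :
    0 ≤ (1 + ex (bernoulliWeight p) (ind G)) * ex (bernoulliWeight p) (ind (A ∩ B ∩ G))
        - ex (bernoulliWeight p) (ind G) * ex (bernoulliWeight p) (ind (A ∩ B))
        - ex (bernoulliWeight p) (ind (A ∩ G)) * ex (bernoulliWeight p) (ind (B ∩ G)) :=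
  fIneq_nonneg_fin_of_cube p A B G (fun s => decide (cubeEquivSet n s ∈ A)) (fun s => decide (cubeEquivSet n s ∈ B))
    (fun s => decide (cubeEquivSet n s ∈ G)) (rep_decide A) (rep_decide B) (rep_decide G)
    (SahiFComb.F_nonneg_of_monotone (fun i => (p i : ℝ)) (fun i => (p i).2.1) (fun i => (p i).2.2)
      (fun s => decide (cubeEquivSet n s ∈ A)) (fun s => decide (cubeEquivSet n s ∈ B)) (fun s => decide (cubeEquivSet n s ∈ G))
      (monotone_of_rep hA (rep_decide A)) (monotone_of_rep hB (rep_decide B)) (monotone_of_rep hG (rep_decide G)))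

end Cube

/-! ### 2. Any finite index type -/

section Transport

variable {ι : Type} [Fintype ι]

/-- **THEOREM (`F ≥ 0` for every increasing third event).**  For every finite `ι`, every `p : ι → [0,1]` and all increasing
`A, B, G ⊆ Set (Set ι)`:  `(1 + 𝔼1_G)·𝔼1_{A∩B∩G} − 𝔼1_G·𝔼1_{A∩B} − 𝔼1_{A∩G}·𝔼1_{B∩G} ≥ 0` under `bernoulliWeight p`. [this work] -/
theorem fIneq_nonneg (p : ι → unitInterval) (A B G : Set (Set ι))
    (hA : IsUpperSet A) (hB : IsUpperSet B) (hG : IsUpperSet G) :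
    0 ≤ (1 + ex (bernoulliWeight p) (ind G)) * ex (bernoulliWeight p) (ind (A ∩ B ∩ G))
        - ex (bernoulliWeight p) (ind G) * ex (bernoulliWeight p) (ind (A ∩ B))
        - ex (bernoulliWeight p) (ind (A ∩ G)) * ex (bernoulliWeight p) (ind (B ∩ G)) := by
  obtain ⟨e⟩ : Nonempty (ι ≃ Fin (Fintype.card ι)) := ⟨Fintype.equivFin ι⟩
  refine fIneq_nonneg_of_equiv e p A B G ?_
  exact fIneq_nonneg_fin (p ∘ e.symm) _ _ _ (isUpperSet_comapFam e hA) (isUpperSet_comapFam e hB) (isUpperSet_comapFam e hG)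

end Transport

/-! ### 3. The D0-core consequence, unconditional in the third member -/

section Core

variable {ι : Type} [Fintype ι]
variable (p : ι → unitInterval) (e : ι) (U : Fin 3 → Set (Set ι)) (hU : ∀ j, IsUpperSet (U j))
  (hG : secAt e true (U 2) = secAt e false (U 2))
  (hXG : secAt e false (U 0) ⊆ secAt e false (U 2)) (hYG : secAt e false (U 1) ⊆ secAt e false (U 2))
  (hXY : ex (bernoulliWeight p) (ind (secAt e false (U 0) ∩ secAt e false (U 1)))
    = ex (bernoulliWeight p) (ind (secAt e false (U 0))) * ex (bernoulliWeight p) (ind (secAt e false (U 1))))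
include hU hG hXG hYG hXY

/-- **MD₃ on the D0 core, no hypothesis on the shape of the third member.**  Under the hypotheses of
`Pointwise.sahiE_three_ge_sq_minor_of_F_nonneg` (increasing triple `U`, `e`-free third member whose `0`-section contains both
`0`-sections of `U_0, U_1`, these independent):  `(1−p_e)²E₃(U⁰) + p_e²E₃(U¹) ≤ E₃(U)`. [this work] -/
theorem sahiE_three_ge_sq_minor :
    (1 - (p e : ℝ)) ^ 2 * sahiE (bernoulliWeight p) 3 (fun j => ind (secAt e false (U j)))
      + (p e : ℝ) ^ 2 * sahiE (bernoulliWeight p) 3 (fun j => ind (secAt e true (U j)))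
      ≤ sahiE (bernoulliWeight p) 3 (fun j => ind (U j)) := by
  refine Pointwise.sahiE_three_ge_sq_minor_of_F_nonneg p e U hU hG hXG hYG hXY ?_
  exact fIneq_nonneg p _ _ _ (isUpperSet_secAt e true (hU 0)) (isUpperSet_secAt e true (hU 1)) (isUpperSet_secAt e false (hU 2))

end Core

end SahiFCombBridge

end Summit.CriticalPhenomena.PercolationContinuityZ3.Theorems
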